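import Summits.PneNP.PneNP.Theorems.SfmBlMachineDictPieces
import Summits.PneNP.PneNP.Theorems.SfmBlConnectedTransfer

/-!
# Line «sfm-bl», MACHINE LAYER M5 dictionary (D1b): the pipeline's leg graph is the machine's piece graph (stmt-PneNP-20523)

FRONTIER F-N1c; nothing here bears on P vs NP.

`SfmBl.cutCertified_of_pipeline` states sparseness (`hsp`) for pairs `(W₁, W₂)` of pieces CONNECTED in
`bipGraph (fun i k => ∃ e, src e = i ∧ dst e = k)`.  For the machine's piece structure of D1 (`srcM`, `dstM` over
`LPiece L I ⊕ RPiece L I`) this graph is, through the label maps `Subtype.val`, the machine's `pieceGraph` on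
labels (M2a): `pieceGraph_adj_iff_exists_leg`, no same-side adjacency (`not_pieceGraph_adj_of_tag_eq`), hence
`connected_pipeline_iff_connected_labels` (via p3's `SfmBl.isConnectedPair_iff_connected_labels`) with the size
bookkeeping `card_labels_eq` and `labels_subset_pieces`.  So a connected pair of the pipeline is a connected set of
piece labels of the same size — the input of `exists_mem_cands` (M2c) in D2.
-/

set_option linter.dupNamespace false -- `Summit.PneNP.PneNP.…`: summit = sub-problem name (D-0017 single-conjunct layout)

namespace Summit.PneNP.PneNP.Theorems.SfmBlMachine

open Literature.Computability.Complexity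
open Summit.PneNP.PneNP.Theorems.Nc03AvoidResidualCoreCandFewHeadsRungFP (trips)
open Summit.PneNP.PneNP.Theorems.SfmBl (bipGraph IsConnectedPair)

variable {n m : ℕ}

/-! ## Tags -/

/-- Left labels carry tag `0`. -/
theorem labL_tag (x : PLeg) : (labL x).1 = 0 := rfl

/-- Right labels carry tag `1`. -/
theorem labR_tag (x : PLeg) : (labR x).1 = 1 := rfl

/-- A left piece label has tag `0`. -/
theorem LPiece.tag {L : ℕ} {I : LocalMap 3 n m} (P : LPiece L I) : P.1.1 = 0 := by
  obtain ⟨x, _, hx⟩ := List.mem_map.1 P.2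
  rw [← hx]; rfl

/-- A right piece label has tag `1`. -/
theorem RPiece.tag {L : ℕ} {I : LocalMap 3 n m} (Q : RPiece L I) : Q.1.1 = 1 := by
  obtain ⟨x, _, hx⟩ := List.mem_map.1 Q.2
  rw [← hx]; rfl

/-- Left and right piece labels differ. -/
theorem LPiece.val_ne {L : ℕ} {I : LocalMap 3 n m} (P : LPiece L I) (Q : RPiece L I) : P.1 ≠ Q.1 := by
  intro h
  have h1 := LPiece.tag P
  rw [h, RPiece.tag Q] at h1
  exact absurd h1 (by decide)

/-! ## Adjacency -/

/-- No leg has two labels of the same tag: a label in `nbrs plegs P` has the tag opposite to `P`'s. -/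
theorem tag_ne_of_mem_nbrs (plegs : List PLeg) {P Q : Lab} (h : Q ∈ nbrs plegs P) : Q.1 ≠ P.1 := by
  unfold nbrs at h
  rw [List.mem_append, List.mem_map, List.mem_map] at h
  rcases h with ⟨x, hx, rfl⟩ | ⟨x, hx, rfl⟩
  · rw [List.mem_filter, decide_eq_true_eq] at hx
    rw [← hx.2, labL_tag, labR_tag]; decide
  · rw [List.mem_filter, decide_eq_true_eq] at hx
    rw [← hx.2, labL_tag, labR_tag]; decide

/-- No adjacency between labels of the same tag. -/
theorem not_pieceGraph_adj_of_tag_eq (plegs : List PLeg) {P Q : Lab} (h : P.1 = Q.1) :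
    ¬ (pieceGraph plegs).Adj P Q := by
  rw [pieceGraph_adj]
  rintro ⟨_, hQ⟩
  exact tag_ne_of_mem_nbrs plegs hQ h.symm

/-- ADJACENCY DICTIONARY: a left piece and a right piece are adjacent in the machine's piece graph iff some leg of the
instance joins them (the relation `∃ e, src e = i ∧ dst e = k` of the pipeline). -/
theorem pieceGraph_adj_iff_exists_leg (L : ℕ) (I : LocalMap 3 n m) (i : LPiece L I) (k : RPiece L I) :
    (pieceGraph (pieceLegs L (trips I))).Adj i.1 k.1 ↔ ∃ e, srcM L I e = i ∧ dstM L I e = k := by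
  rw [pieceGraph_adj]
  constructor
  · rintro ⟨_, hk⟩
    unfold nbrs at hk
    rw [List.mem_append, List.mem_map, List.mem_map] at hk
    rcases hk with ⟨x, hx, hxk⟩ | ⟨x, hx, hxk⟩
    · rw [List.mem_filter, decide_eq_true_eq] at hx
      obtain ⟨e, rfl⟩ := exists_eq_plegOf L I hx.1
      exact ⟨e, Subtype.ext hx.2, Subtype.ext hxk⟩
    · -- a left label of a leg cannot be the right piece `k`
      have : (labL x).1 = k.1.1 := by rw [hxk]
      rw [RPiece.tag k, labL_tag] at this
      exact absurd this (by decide)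
  · rintro ⟨e, rfl, rfl⟩
    refine ⟨LPiece.val_ne _ _, ?_⟩
    unfold nbrs
    rw [List.mem_append]
    left
    exact List.mem_map.2 ⟨plegOf L I e, List.mem_filter.2 ⟨plegOf_mem L I e, by rw [decide_eq_true_eq]; rfl⟩, rfl⟩

/-! ## Connectivity of a pipeline pair = connectivity of its label set -/

/-- The label set of a pair of piece sets. -/
def labelsOf {L : ℕ} {I : LocalMap 3 n m} (W₁ : Finset (LPiece L I)) (W₂ : Finset (RPiece L I)) : Finset Lab :=
  W₁.image Subtype.val ∪ W₂.image Subtype.val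

/-- The label set has `|W₁| + |W₂|` elements. -/
theorem card_labelsOf {L : ℕ} {I : LocalMap 3 n m} (W₁ : Finset (LPiece L I)) (W₂ : Finset (RPiece L I)) :
    (labelsOf W₁ W₂).card = W₁.card + W₂.card :=
  SfmBl.card_image_union_image Subtype.val Subtype.val W₁ W₂ (Subtype.val_injective.injOn)
    (Subtype.val_injective.injOn) (fun i _ k _ => LPiece.val_ne i k)

/-- Every label of the label set is a piece of the machine. -/
theorem labelsOf_subset_pieces {L : ℕ} {I : LocalMap 3 n m} (W₁ : Finset (LPiece L I)) (W₂ : Finset (RPiece L I)) :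
    ∀ P ∈ labelsOf W₁ W₂, P ∈ pieces (pieceLegs L (trips I)) := by
  intro P hP
  unfold labelsOf at hP
  unfold pieces
  rw [List.mem_dedup, List.mem_append]
  rcases Finset.mem_union.1 hP with h | h
  · obtain ⟨i, _, rfl⟩ := Finset.mem_image.1 h
    exact Or.inl i.2
  · obtain ⟨k, _, rfl⟩ := Finset.mem_image.1 h
    exact Or.inr k.2

/-- The left labels of the label set are those of `W₁`. -/
theorem mem_labelsOf_left {L : ℕ} {I : LocalMap 3 n m} (W₁ : Finset (LPiece L I)) (W₂ : Finset (RPiece L I))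
    (i : LPiece L I) : i.1 ∈ labelsOf W₁ W₂ ↔ i ∈ W₁ := by
  unfold labelsOf
  rw [Finset.mem_union, Finset.mem_image, Finset.mem_image]
  constructor
  · rintro (⟨i', hi', h⟩ | ⟨k, _, h⟩)
    · rwa [← Subtype.ext h]
    · exact absurd h.symm (LPiece.val_ne i k)
  · intro h; exact Or.inl ⟨i, h, rfl⟩

/-- The right labels of the label set are those of `W₂`. -/
theorem mem_labelsOf_right {L : ℕ} {I : LocalMap 3 n m} (W₁ : Finset (LPiece L I)) (W₂ : Finset (RPiece L I))
    (k : RPiece L I) : k.1 ∈ labelsOf W₁ W₂ ↔ k ∈ W₂ := by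
  unfold labelsOf
  rw [Finset.mem_union, Finset.mem_image, Finset.mem_image]
  constructor
  · rintro (⟨i, _, h⟩ | ⟨k', hk', h⟩)
    · exact absurd h (LPiece.val_ne i k)
    · rwa [← Subtype.ext h]
  · intro h; exact Or.inr ⟨k, h, rfl⟩

/-- **CONNECTIVITY DICTIONARY**: a pair `(W₁, W₂)` of machine pieces is connected for the pipeline's leg relation
(`hsp`'s `Sum.elim` spelling) iff its label set is connected in the machine's piece graph. -/
theorem connected_pipeline_iff_connected_labels (L : ℕ) (I : LocalMap 3 n m)
    (W₁ : Finset (LPiece L I)) (W₂ : Finset (RPiece L I)) :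
    ((bipGraph (fun i k => ∃ e, srcM L I e = i ∧ dstM L I e = k)).induce
        {x | Sum.elim (fun i => i ∈ W₁) (fun k => k ∈ W₂) x}).Connected
      ↔ ((pieceGraph (pieceLegs L (trips I))).induce (labelsOf W₁ W₂ : Set Lab)).Connected := by
  rw [← SfmBl.isConnectedPair_iff_sumElim]
  unfold labelsOf
  exact SfmBl.isConnectedPair_iff_connected_labels _ (pieceGraph (pieceLegs L (trips I))) Subtype.val Subtype.val
    W₁ W₂ (Subtype.val_injective.injOn) (Subtype.val_injective.injOn) (fun i _ k _ => LPiece.val_ne i k)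
    (fun i _ i' _ => not_pieceGraph_adj_of_tag_eq _ (by rw [LPiece.tag i, LPiece.tag i']))
    (fun k _ k' _ => not_pieceGraph_adj_of_tag_eq _ (by rw [RPiece.tag k, RPiece.tag k']))
    (fun i _ k _ => (pieceGraph_adj_iff_exists_leg L I i k).symm)

end Summit.PneNP.PneNP.Theorems.SfmBlMachine
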